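import Summits.QuantumFields.GaugeBoot.EquipartitionDLR
import Summits.QuantumFields.GaugeBoot.ClassBBootstrapSoundnessZd
import Summits.QuantumFields.GaugeBoot.BootstrapSpaceGroupReductionZd
import Summits.QuantumFields.GaugeBoot.OrbitAverages
import HarnessLib

/-!
# Gauge-boot: THE EQUIPARTITION CEILING FOR THE SYMMETRY-REDUCED AND THE COMPLETE KAZAKOV–ZHENG SDP ON `ℤ^d` —
# no certificate of the infinite-lattice bootstrap at word level `≥ 4` can put a single plaquette above
# `1 − (N² − 1)/(4(d−1)β_std + N² − 1)` (large-`N` supplement 19, part 6)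

HONEST FRAMING (cell `pub-gaugeboot`, page 1 of every file): certified bounds on lattice
expectations at STATED coupling, gauge group, dimension and torus size; NOT a mass gap, NOT a
continuum limit, NOT a string tension, NOT large `N`; NOT Yang–Mills-summit-bearing (barriers
`FixedCouplingUltralocality`, `PerturbativeInvisibility`).  An a-priori ceiling on the UPPER bounds of the
infinite-lattice SDPs; it certifies no number of CERTIFIED.md.

## Content

Part 4 bounds the `2(d−1)` plaquettes through a link at every feasible point of the plain word SDP on `ℤ^d`; part 5 the
plane sum for translation-invariant functionals.  Kazakov–Zheng's infinite-lattice SDP labels Wilson loops by SHAPE, i.e.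
its functionals are invariant under translations AND the point group (`spaceSymLevelValuesZdSuN`, `fullSymLevelValuesZdSuN`,
`rpFullSymLevelValuesZdSuN`, the complete `kzLevelValuesZdSuN` of `ClassBBootstrapSoundnessZd`).  For such functionals all
plaquettes have one value, so the link average IS the plaquette:

* `plaquetteZdCM_perm_comp_relabelCM_edgePerm` — `u_{σ⁻¹x; σ⁻¹i, σ⁻¹j} ∘ π_σ = u_{x;ij}`;
* ★ `apply_plaquette_eq_of_symmetric` — a functional translation- and permutation-invariant on the words of length `≤ 2n`
  (`n ≥ 2`) gives all plaquettes `u_{y;ab}` (`a ≠ b`) the same value;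
* ★★★ `apply_plaquette_le_of_symmetric_feasible` — for `N ≥ 2`, `d ≥ 2`, tree coupling `β ≥ 0` and every such functional
  feasible at level `n ≥ 4`: **`φ(u_{x;ij}) ≤ 1 − (N − 1/N)/(4(d−1)β + N − 1/N)`** for EVERY plaquette; `…_std`: at
  `β = β_std/N` the ceiling is `1 − (N² − 1)/(4(d−1)β_std + N² − 1)` (`SU(3)`, `d = 4`, `β_std = 6`: `≤ 9/10`);
* ★★★ set forms: `spaceSymLevelValuesZd_plaquette_le`, `fullSymLevelValuesZd_plaquette_le`, `rpFullSymLevelValuesZd_plaquette_le`,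
  `kzLevelValuesZd_plaquette_le` — every value of `u_P` in the space-group-reduced / fully reduced / RP-cut / COMPLETE KZ
  level-`n ≥ 4` SDP on `ℤ^d` is `≤ 1 − δ`; `sSup_kzLevelValuesZd_plaquette_le`.
So the analytic SANITY CEILING of supplement 18 (torus) holds verbatim for the infinite-lattice SDPs of the bootstrap
literature: a reported upper bound on `u_P` above `1 − (N² − 1)/(4(d−1)β_std + N² − 1)` at level `≥ 4` is an error.
[folklore]
-/

noncomputable section

open MeasureTheory Filter Topology NormedSpace
open scoped Matrix
open Literature.Probability.LatticeModels (Site)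
open Literature.MathematicalPhysics.QuantumFieldTheory (LatticeRep)
open Literature.MathematicalPhysics.QuantumLattice (fundamentalLatticeRep fundamentalRep fundamentalLatticeRep_N LGConfig
  ZdEdge plaquetteObs plaquetteHolonomyZd wilsonBoundaryAction edgeShift edgePerm sitePerm
  plaquetteHolonomyZd_relabel_edgePerm)

namespace Summit.QuantumFields.GaugeBoot

namespace EquipartitionZd

open TiltedRP (plaquetteZdCM plaquetteZdCM_apply plaquetteZdCM_mem_wordTruncation zdUnit zdUnit_apply)

variable {d N : ℕ}

/-! ## Axis permutations of the plaquette observable -/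

section Perm

variable {G : Type} [Group G] [TopologicalSpace G] [IsTopologicalGroup G] [MeasurableSpace G] (r : LatticeRep G)

/-- **Permuting the axes**: `u_{σ⁻¹x; σ⁻¹i, σ⁻¹j} ∘ π_σ = u_{x;ij}` (`π_σ = relabelCM (edgePerm σ)`). [folklore] -/
theorem plaquetteZdCM_perm_comp_relabelCM_edgePerm (σ : Equiv.Perm (Fin d)) (x : Site d) (i j : Fin d) :
    (plaquetteZdCM r (sitePerm σ⁻¹ x) (σ⁻¹ i) (σ⁻¹ j)).comp (relabelCM (G := G) (edgePerm σ)) =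
      plaquetteZdCM r x i j := by
  ext U
  rw [ContinuousMap.comp_apply, plaquetteZdCM_apply, plaquetteZdCM_apply, plaquetteObs, plaquetteObs]
  change _ * (r.ρ (plaquetteHolonomyZd (⇑(relabelCM (G := G) (edgePerm σ)) U) _ _ _)).trace.re = _
  rw [relabelCM_edgePerm_eq_relabelConfig, plaquetteHolonomyZd_relabel_edgePerm]

end Perm

/-! ## Symmetric functionals give every plaquette the same value -/

section Symmetric

variable {φ : C(LGConfig d (Matrix.specialUnitaryGroup (Fin N) ℂ), ℝ) →ₗ[ℝ] ℝ} {n : ℕ}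

/-- Translation invariance on the words of length `≤ 2n` (`n ≥ 2`) identifies the plaquettes of one plane. [folklore] -/
theorem apply_plaquette_add_eq_of_translationInvariant (hn : 2 ≤ n)
    (hT : ∀ (v : Fin d → ℤ), ∀ P ∈ wordTruncation (ι := ZdEdge d) (fundamentalLatticeRep N) (n + n),
      φ (P.comp (relabelCM (G := Matrix.specialUnitaryGroup (Fin N) ℂ) (edgeShift v))) = φ P)
    (x v : Site d) (i j : Fin d) :
    φ (plaquetteZdCM (fundamentalLatticeRep N) (x + v) i j) = φ (plaquetteZdCM (fundamentalLatticeRep N) x i j) := by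
  rw [← plaquetteZdCM_comp_relabelCM_edgeShift x i j v]
  exact hT v _ (plaquetteZdCM_mem_wordTruncation (fundamentalLatticeRep N) (by omega) x i j)

/-- ★ **A translation- and permutation-invariant functional gives ALL plaquettes the same value**:
`φ(u_{y;ab}) = φ(u_{x;ij})` for `a ≠ b`, `i ≠ j`. [folklore] -/
theorem apply_plaquette_eq_of_symmetric (hn : 2 ≤ n)
    (hT : ∀ (v : Fin d → ℤ), ∀ P ∈ wordTruncation (ι := ZdEdge d) (fundamentalLatticeRep N) (n + n),
      φ (P.comp (relabelCM (G := Matrix.specialUnitaryGroup (Fin N) ℂ) (edgeShift v))) = φ P)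
    (hperm : ∀ (σ : Equiv.Perm (Fin d)), ∀ P ∈ wordTruncation (ι := ZdEdge d) (fundamentalLatticeRep N) (n + n),
      φ (P.comp (relabelCM (G := Matrix.specialUnitaryGroup (Fin N) ℂ) (edgePerm σ))) = φ P)
    (x y : Site d) {i j a b : Fin d} (hij : i ≠ j) (hab : a ≠ b) :
    φ (plaquetteZdCM (fundamentalLatticeRep N) y a b) = φ (plaquetteZdCM (fundamentalLatticeRep N) x i j) := by
  obtain ⟨σ, hσa, hσb⟩ := exists_perm_apply_eq (d := d) hij hab
  have ha : σ⁻¹ i = a := by rw [← hσa, Equiv.Perm.inv_def, Equiv.symm_apply_apply]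
  have hb : σ⁻¹ j = b := by rw [← hσb, Equiv.Perm.inv_def, Equiv.symm_apply_apply]
  -- permutation: `φ(u_{x;ij}) = φ(u_{σ⁻¹x; ab})`
  have h1 : φ (plaquetteZdCM (fundamentalLatticeRep N) x i j) =
      φ (plaquetteZdCM (fundamentalLatticeRep N) (sitePerm σ⁻¹ x) a b) := by
    rw [← plaquetteZdCM_perm_comp_relabelCM_edgePerm (fundamentalLatticeRep N) σ x i j, ha, hb]
    exact hperm σ _ (plaquetteZdCM_mem_wordTruncation (fundamentalLatticeRep N) (by omega) _ a b)
  -- translation: `φ(u_{σ⁻¹x; ab}) = φ(u_{y;ab})`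
  have h2 : φ (plaquetteZdCM (fundamentalLatticeRep N) (sitePerm σ⁻¹ x) a b) =
      φ (plaquetteZdCM (fundamentalLatticeRep N) y a b) := by
    have h := apply_plaquette_add_eq_of_translationInvariant hn hT y (sitePerm σ⁻¹ x - y) a b
    rwa [add_sub_cancel] at h
  rw [h1, h2]

/-- ★★★ **THE EQUIPARTITION CEILING FOR EVERY PLAQUETTE AT EVERY SYMMETRIC FEASIBLE POINT OF THE `ℤ^d` SDP.**
`N ≥ 2`, `d ≥ 2`, tree coupling `β ≥ 0`, `φ` feasible for the word-level-`n` bootstrap on `ℤ^d` with `n ≥ 4` and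
invariant on the words of length `≤ 2n` under translations and axis permutations ("loops by shape"): for every plaquette
`(x; i ≠ j)`, `φ(u_{x;ij}) ≤ 1 − (N − 1/N)/(4(d−1)β + N − 1/N)`. [folklore] -/
theorem apply_plaquette_le_of_symmetric_feasible (hN : 2 ≤ N) (hd : 2 ≤ d) {β : ℝ} (hβ : 0 ≤ β) (hn : 4 ≤ n)
    (hφ : IsBootstrapFeasible (fundamentalLatticeRep N) (suExp N)
      (fun e => wilsonBoundaryAction (fundamentalRep (Fin N)) {e}) β
      (wordTruncation (ι := ZdEdge d) (fundamentalLatticeRep N) n) φ)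
    (hT : ∀ (v : Fin d → ℤ), ∀ P ∈ wordTruncation (ι := ZdEdge d) (fundamentalLatticeRep N) (n + n),
      φ (P.comp (relabelCM (G := Matrix.specialUnitaryGroup (Fin N) ℂ) (edgeShift v))) = φ P)
    (hperm : ∀ (σ : Equiv.Perm (Fin d)), ∀ P ∈ wordTruncation (ι := ZdEdge d) (fundamentalLatticeRep N) (n + n),
      φ (P.comp (relabelCM (G := Matrix.specialUnitaryGroup (Fin N) ℂ) (edgePerm σ))) = φ P)
    (x : Site d) {i j : Fin d} (hij : i ≠ j) :
    φ (plaquetteZdCM (fundamentalLatticeRep N) x i j) ≤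
      1 - ((N : ℝ) - 1 / N) / (4 * ((d : ℝ) - 1) * β + ((N : ℝ) - 1 / N)) := by
  have h := TiltedRP.Equipartition.sum_plaquette_le_of_isBootstrapFeasible_zdSuN hN hn hd hβ hφ x i
  have hn2 : 2 ≤ n := by omega
  have hterm : ∀ ν ∈ Finset.univ.erase i,
      (φ (plaquetteZdCM (fundamentalLatticeRep N) x i ν) + φ (plaquetteZdCM (fundamentalLatticeRep N) (x - zdUnit d ν) i ν)) =
      2 * φ (plaquetteZdCM (fundamentalLatticeRep N) x i j) := by
    intro ν hν
    have hiν : i ≠ ν := (Finset.ne_of_mem_erase hν).symm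
    rw [apply_plaquette_eq_of_symmetric hn2 hT hperm x x hij hiν,
      apply_plaquette_eq_of_symmetric hn2 hT hperm x (x - zdUnit d ν) hij hiν]
    ring
  rw [Finset.sum_congr rfl hterm, Finset.sum_const, Finset.card_erase_of_mem (Finset.mem_univ i), Finset.card_univ,
    Fintype.card_fin, nsmul_eq_mul, Nat.cast_sub (by omega : 1 ≤ d), Nat.cast_one] at h
  have hd0 : (0 : ℝ) < (d : ℝ) - 1 := by
    have : (2 : ℝ) ≤ d := by exact_mod_cast hd
    linarith
  nlinarith [h]

/-- **Cell normalisation** (`β = β_std/N`): `φ(u_{x;ij}) ≤ 1 − (N² − 1)/(4(d−1)β_std + N² − 1)`. [folklore] -/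
theorem apply_plaquette_le_of_symmetric_feasible_std (hN : 2 ≤ N) (hd : 2 ≤ d) {β : ℝ} (hβ : 0 ≤ β) (hn : 4 ≤ n)
    (hφ : IsBootstrapFeasible (fundamentalLatticeRep N) (suExp N)
      (fun e => wilsonBoundaryAction (fundamentalRep (Fin N)) {e}) (β / N)
      (wordTruncation (ι := ZdEdge d) (fundamentalLatticeRep N) n) φ)
    (hT : ∀ (v : Fin d → ℤ), ∀ P ∈ wordTruncation (ι := ZdEdge d) (fundamentalLatticeRep N) (n + n),
      φ (P.comp (relabelCM (G := Matrix.specialUnitaryGroup (Fin N) ℂ) (edgeShift v))) = φ P)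
    (hperm : ∀ (σ : Equiv.Perm (Fin d)), ∀ P ∈ wordTruncation (ι := ZdEdge d) (fundamentalLatticeRep N) (n + n),
      φ (P.comp (relabelCM (G := Matrix.specialUnitaryGroup (Fin N) ℂ) (edgePerm σ))) = φ P)
    (x : Site d) {i j : Fin d} (hij : i ≠ j) :
    φ (plaquetteZdCM (fundamentalLatticeRep N) x i j) ≤
      1 - ((N : ℝ) ^ 2 - 1) / (4 * ((d : ℝ) - 1) * β + ((N : ℝ) ^ 2 - 1)) := by
  have hN0 : (0 : ℝ) < N := by exact_mod_cast (by omega : 0 < N)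
  have h := apply_plaquette_le_of_symmetric_feasible hN hd (div_nonneg hβ hN0.le) hn hφ hT hperm x hij
  have hb := linkBound_div (d := d) hN hd hβ
  rw [linkBound_eq] at hb
  have hd0 : (0 : ℝ) < 2 * ((d : ℝ) - 1) := by
    have : (2 : ℝ) ≤ d := by exact_mod_cast hd
    linarith
  have hb' := mul_left_cancel₀ hd0.ne' hb
  linarith [hb']

end Symmetric

/-! ## Set forms: the reduced and the complete Kazakov–Zheng SDPs on `ℤ^d` -/

section Sets

variable (N) in
/-- The per-plaquette ceiling `1 − (N − 1/N)/(4(d−1)β + N − 1/N)` (tree coupling). [folklore] -/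
def plaquetteBound (d N : ℕ) (β : ℝ) : ℝ :=
  1 - ((N : ℝ) - 1 / N) / (4 * ((d : ℝ) - 1) * β + ((N : ℝ) - 1 / N))

/-- Unfolding lemma. [folklore] -/
theorem plaquetteBound_eq (d N : ℕ) (β : ℝ) :
    plaquetteBound d N β = 1 - ((N : ℝ) - 1 / N) / (4 * ((d : ℝ) - 1) * β + ((N : ℝ) - 1 / N)) := rfl

/-- At `β_std/N`: `plaquetteBound d N (β_std/N) = 1 − (N² − 1)/(4(d−1)β_std + N² − 1)`. [folklore] -/
theorem plaquetteBound_div (hN : 2 ≤ N) (hd : 2 ≤ d) {β : ℝ} (hβ : 0 ≤ β) :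
    plaquetteBound d N (β / N) = 1 - ((N : ℝ) ^ 2 - 1) / (4 * ((d : ℝ) - 1) * β + ((N : ℝ) ^ 2 - 1)) := by
  have hb := linkBound_div (d := d) hN hd hβ
  rw [linkBound_eq] at hb
  have hd0 : (0 : ℝ) < 2 * ((d : ℝ) - 1) := by
    have : (2 : ℝ) ≤ d := by exact_mod_cast hd
    linarith
  rw [plaquetteBound_eq]
  exact mul_left_cancel₀ hd0.ne' hb

/-- ★★★ **The SPACE-GROUP-REDUCED SDP** (translations + axis permutations, level `n ≥ 4`): every value of `u_{x;ij}` is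
`≤ 1 − δ`. [folklore] -/
theorem spaceSymLevelValuesZd_plaquette_le (hN : 2 ≤ N) (hd : 2 ≤ d) {β : ℝ} (hβ : 0 ≤ β) {n : ℕ} (hn : 4 ≤ n)
    (x : Site d) {i j : Fin d} (hij : i ≠ j) {t : ℝ}
    (ht : t ∈ spaceSymLevelValuesZdSuN (d := d) N β n (plaquetteZdCM (fundamentalLatticeRep N) x i j)) :
    t ≤ plaquetteBound d N β := by
  obtain ⟨φ, hφ, hT, hperm, rfl⟩ := ht
  exact apply_plaquette_le_of_symmetric_feasible hN hd hβ hn hφ hT hperm x hij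

/-- ★★ **The FULLY REDUCED SDP** (`B_d ⋉ ℤ^d`, level `n ≥ 4`): every value of `u_{x;ij}` is `≤ 1 − δ`. [folklore] -/
theorem fullSymLevelValuesZd_plaquette_le (hN : 2 ≤ N) (hd : 2 ≤ d) {β : ℝ} (hβ : 0 ≤ β) {n : ℕ} (hn : 4 ≤ n)
    (x : Site d) {i j : Fin d} (hij : i ≠ j) {t : ℝ}
    (ht : t ∈ fullSymLevelValuesZdSuN (d := d) N β n (plaquetteZdCM (fundamentalLatticeRep N) x i j)) :
    t ≤ plaquetteBound d N β := by
  obtain ⟨φ, hφ, hT, hperm, -, rfl⟩ := ht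
  exact apply_plaquette_le_of_symmetric_feasible hN hd hβ hn hφ hT hperm x hij

/-- ★★ **The fully reduced SDP WITH the site- and link-RP cuts** (level `n ≥ 4`): every value of `u_{x;ij}` is `≤ 1 − δ`.
[folklore] -/
theorem rpFullSymLevelValuesZd_plaquette_le (hN : 2 ≤ N) (hd : 2 ≤ d) {β : ℝ} (hβ : 0 ≤ β) {n : ℕ} (hn : 4 ≤ n)
    (x : Site d) {i j : Fin d} (hij : i ≠ j) {t : ℝ}
    (ht : t ∈ rpFullSymLevelValuesZdSuN (d := d) N β n (plaquetteZdCM (fundamentalLatticeRep N) x i j)) :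
    t ≤ plaquetteBound d N β := by
  obtain ⟨φ, hφ, hT, hperm, -, -, -, rfl⟩ := ht
  exact apply_plaquette_le_of_symmetric_feasible hN hd hβ hn hφ hT hperm x hij

/-- ★★★ **THE COMPLETE KAZAKOV–ZHENG SDP ON `ℤ^d`** (loop equations, positivity, `ℤ^d ⋊ B_d` reduction, the three RP cut
families; the Class-B certificate interface of the cell) at level `n ≥ 4`: every feasible value of a plaquette is
`≤ 1 − (N − 1/N)/(4(d−1)β + N − 1/N)` — its certified upper bound on `u_P` can never exceed the equipartition ceiling.
[folklore] -/
theorem kzLevelValuesZd_plaquette_le (hN : 2 ≤ N) (hd : 2 ≤ d) {β : ℝ} (hβ : 0 ≤ β) {n : ℕ} (hn : 4 ≤ n)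
    (x : Site d) {i j : Fin d} (hij : i ≠ j) {t : ℝ}
    (ht : t ∈ kzLevelValuesZdSuN (d := d) N β n (plaquetteZdCM (fundamentalLatticeRep N) x i j)) :
    t ≤ plaquetteBound d N β := by
  obtain ⟨φ, hφ, hT, hperm, -, -, -, -, rfl⟩ := ht
  exact apply_plaquette_le_of_symmetric_feasible hN hd hβ hn hφ hT hperm x hij

/-- The same in cell normalisation: values of the complete KZ SDP at `β_std/N` are
`≤ 1 − (N² − 1)/(4(d−1)β_std + N² − 1)`. [folklore] -/
theorem kzLevelValuesZd_plaquette_le_std (hN : 2 ≤ N) (hd : 2 ≤ d) {β : ℝ} (hβ : 0 ≤ β) {n : ℕ} (hn : 4 ≤ n)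
    (x : Site d) {i j : Fin d} (hij : i ≠ j) {t : ℝ}
    (ht : t ∈ kzLevelValuesZdSuN (d := d) N (β / N) n (plaquetteZdCM (fundamentalLatticeRep N) x i j)) :
    t ≤ 1 - ((N : ℝ) ^ 2 - 1) / (4 * ((d : ℝ) - 1) * β + ((N : ℝ) ^ 2 - 1)) := by
  have hN0 : (0 : ℝ) < N := by exact_mod_cast (by omega : 0 < N)
  rw [← plaquetteBound_div hN hd hβ]
  exact kzLevelValuesZd_plaquette_le hN hd (div_nonneg hβ hN0.le) hn x hij ht

/-- Every Class-B state's plaquette is a complete-KZ value, so the two ceilings agree: a sanity restatement of part 5's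
`ClassBState.integral_plaquette_le` through `ClassBState.integral_mem_kzLevelValuesZd`. [folklore] -/
theorem ClassBState.integral_plaquetteZdCM_le (hN : 2 ≤ N) (hd : 2 ≤ d) {β : ℝ} (hβ : 0 ≤ β)
    (ω : ClassBState d (fundamentalRep (Fin N)) β) (x : Site d) {i j : Fin d} (hij : i ≠ j) :
    ∫ U, plaquetteZdCM (fundamentalLatticeRep N) x i j U ∂ω.μ ≤ plaquetteBound d N β :=
  kzLevelValuesZd_plaquette_le hN hd hβ le_rfl x hij (ω.integral_mem_kzLevelValuesZd N β 4 _)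

end Sets

end EquipartitionZd

end Summit.QuantumFields.GaugeBoot

end
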